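import Mathlib.Analysis.Calculus.FDeriv.Analytic
import Mathlib.Analysis.Analytic.Uniqueness
import Mathlib.Analysis.Calculus.Deriv.Add
import Literature.Analysis.Calculus.AnalyticFlatness
import HarnessLib

/-!
# Analytic flatness on an interval for a family closed under `d/ds`

Topic `Analysis/Calculus`; namespace `Literature.Analysis.Calculus`; theorems only (no definition, no named fact, no
`sorry`).  The one-variable reading of ★ `eventuallyEq_zero_of_mem_of_closed_dirDeriv'` ([denBesten2016, Lemma 3.1.6],
real-analytic case) in the form used to integrate infinitesimal identities of `(𝔤, K)`-modules along one-parameter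
subgroups (cell `hodgecm-mathlib`, F0∕P3, ROAD-GLOB to the letter A6 `HasUnitaryGlobalizationOfInfUnitary` at `U(2,1)`,
bricks P3∕Φ2: «a family `{f_u}` of real-analytic matrix coefficients with `f_u' = f_{D u}` and `f_u(s₀) = 0` vanishes»).

Let `J ⊆ ℝ` be open and preconnected, `s₀ ∈ J`, and let `f : V → ℝ → F` be a family of functions (`F` a complete real
normed space, `V` any index type) with a self-map `D : V → V` such that every `f u` is analytic on `J`,
`HasDerivAt (f u) (f (D u) s) s` for `s ∈ J`, and `f u s₀ = 0`.  THEN `f u = 0` on `J` for every `u`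
(`eqOn_zero_of_hasDerivAt_family`): all iterated derivatives `(f u)^{(n)}(s₀) = f (D^n u) (s₀)` vanish, an analytic
function is the sum of its Taylor series, and `J` is preconnected (Mathlib
`AnalyticOnNhd.eqOn_zero_of_preconnected_of_eventuallyEq_zero`).  Also the two-family form
(`eqOn_of_hasDerivAt_family`: `f u s₀ = g u s₀`, `f u' = f (D u)`, `g u' = g (D u)` ⇒ `f u = g u` on `J`).

## Mathlib ∕ tree search
Tree: ★ `Literature.Analysis.Calculus.eventuallyEq_zero_of_mem_of_closed_dirDeriv'` (multi-variable, neighbourhood form;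
this file is its interval corollary).  Mathlib: `AnalyticOnNhd.eqOn_zero_of_preconnected_of_eventuallyEq_zero`,
`Module.Basis.singleton`, `HasDerivAt.deriv`, `fderiv_apply_one_eq_deriv`… Dedup: `rg "hasDerivAt_family|closed_deriv"` over
`Literature/` — no hits.

## References
* M. den Besten, *Wilkie's Theorem and the Uniform Real Schanuel Conjecture*, MSc thesis, Utrecht (2016), Lemma 3.1.6 [denBesten2016].
* E. Nelson, *Analytic vectors*, Ann. of Math. 70 (1959), §2 (uniqueness along analytic orbits) [Nelson1959].
-/

set_option autoImplicit false

noncomputable section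

open scoped Topology
open Set Filter

namespace Literature.Analysis.Calculus

variable {F : Type*} [NormedAddCommGroup F] [NormedSpace ℝ F] [CompleteSpace F] {V : Type*}

/-- **A `d/ds`-closed family of analytic functions vanishing at `s₀` vanishes near `s₀`.**  For `f : V → ℝ → F` with
every `f u` analytic on an open `J ∋ s₀`, `HasDerivAt (f u) (f (D u) s) s` on `J` and `f u s₀ = 0`: `f u =ᶠ[𝓝 s₀] 0`.
[cite: denBesten2016, Lemma 3.1.6 (real-analytic case)] -/
theorem eventuallyEq_zero_of_hasDerivAt_family {J : Set ℝ} (hJ : IsOpen J) {s₀ : ℝ} (hs₀ : s₀ ∈ J)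
    (f : V → ℝ → F) (D : V → V) (han : ∀ u, AnalyticOnNhd ℝ (f u) J)
    (hder : ∀ u, ∀ s ∈ J, HasDerivAt (f u) (f (D u) s) s) (h0 : ∀ u, f u s₀ = 0) (u : V) :
    f u =ᶠ[𝓝 s₀] 0 := by
  classical
  refine eventuallyEq_zero_of_mem_of_closed_dirDeriv' (Module.Basis.singleton Unit ℝ) hJ hs₀ (Set.range f)
    (by rintro _ ⟨u, rfl⟩; exact han u) ?_ (by rintro _ ⟨u, rfl⟩; exact h0 u) ⟨u, rfl⟩
  rintro _ ⟨u, rfl⟩ i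
  refine ⟨f (D u), ⟨D u, rfl⟩, fun s hs => ?_⟩
  rw [dirDeriv_apply, Module.Basis.singleton_apply]
  have h := (hder u s hs).hasFDerivAt
  rw [h.fderiv, ContinuousLinearMap.toSpanSingleton_apply, one_smul]

/-- **Analytic flatness on an interval**: under the same hypotheses with `J` PRECONNECTED, `f u = 0` on all of `J`.
[cite: denBesten2016, Lemma 3.1.6 (real-analytic case)] -/
theorem eqOn_zero_of_hasDerivAt_family {J : Set ℝ} (hJ : IsOpen J) (hJc : IsPreconnected J) {s₀ : ℝ} (hs₀ : s₀ ∈ J)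
    (f : V → ℝ → F) (D : V → V) (han : ∀ u, AnalyticOnNhd ℝ (f u) J)
    (hder : ∀ u, ∀ s ∈ J, HasDerivAt (f u) (f (D u) s) s) (h0 : ∀ u, f u s₀ = 0) (u : V) :
    EqOn (f u) 0 J :=
  (han u).eqOn_zero_of_preconnected_of_eventuallyEq_zero hJc hs₀
    (eventuallyEq_zero_of_hasDerivAt_family hJ hs₀ f D han hder h0 u)

/-- Pointwise form of `eqOn_zero_of_hasDerivAt_family`. [cite: denBesten2016, Lemma 3.1.6 (real-analytic case)] -/
theorem eq_zero_of_hasDerivAt_family {J : Set ℝ} (hJ : IsOpen J) (hJc : IsPreconnected J) {s₀ : ℝ} (hs₀ : s₀ ∈ J)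
    (f : V → ℝ → F) (D : V → V) (han : ∀ u, AnalyticOnNhd ℝ (f u) J)
    (hder : ∀ u, ∀ s ∈ J, HasDerivAt (f u) (f (D u) s) s) (h0 : ∀ u, f u s₀ = 0) (u : V) {s : ℝ} (hs : s ∈ J) :
    f u s = 0 :=
  eqOn_zero_of_hasDerivAt_family hJ hJc hs₀ f D han hder h0 u hs

/-- **Two `d/ds`-closed analytic families that agree at `s₀` agree on `J`** (`F` an additive group: apply the vanishing
form to `f − g`). [cite: denBesten2016, Lemma 3.1.6 (real-analytic case)] -/
theorem eqOn_of_hasDerivAt_family {J : Set ℝ} (hJ : IsOpen J) (hJc : IsPreconnected J) {s₀ : ℝ} (hs₀ : s₀ ∈ J)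
    (f g : V → ℝ → F) (D : V → V) (hf : ∀ u, AnalyticOnNhd ℝ (f u) J) (hg : ∀ u, AnalyticOnNhd ℝ (g u) J)
    (hfder : ∀ u, ∀ s ∈ J, HasDerivAt (f u) (f (D u) s) s) (hgder : ∀ u, ∀ s ∈ J, HasDerivAt (g u) (g (D u) s) s)
    (h0 : ∀ u, f u s₀ = g u s₀) (u : V) : EqOn (f u) (g u) J := by
  have h := eqOn_zero_of_hasDerivAt_family hJ hJc hs₀ (fun u s => f u s - g u s) D
    (fun u => (hf u).sub (hg u)) (fun u s hs => HasDerivAt.sub (hfder u s hs) (hgder u s hs))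
    (fun u => sub_eq_zero.mpr (h0 u)) u
  intro s hs
  exact sub_eq_zero.mp (h hs)

/-- The whole-line form (`J = univ`): a `d/ds`-closed family of functions analytic on `ℝ` that vanishes at one point
vanishes identically. [cite: denBesten2016, Lemma 3.1.6 (real-analytic case)] -/
theorem eq_zero_of_hasDerivAt_family_univ (s₀ : ℝ) (f : V → ℝ → F) (D : V → V)
    (han : ∀ u, AnalyticOnNhd ℝ (f u) univ) (hder : ∀ u s, HasDerivAt (f u) (f (D u) s) s)
    (h0 : ∀ u, f u s₀ = 0) (u : V) (s : ℝ) : f u s = 0 :=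
  eqOn_zero_of_hasDerivAt_family isOpen_univ isPreconnected_univ (mem_univ s₀) f D han
    (fun u s _ => hder u s) h0 u (mem_univ s)

/-- The whole-line two-family form. [cite: denBesten2016, Lemma 3.1.6 (real-analytic case)] -/
theorem eq_of_hasDerivAt_family_univ (s₀ : ℝ) (f g : V → ℝ → F) (D : V → V)
    (hf : ∀ u, AnalyticOnNhd ℝ (f u) univ) (hg : ∀ u, AnalyticOnNhd ℝ (g u) univ)
    (hfder : ∀ u s, HasDerivAt (f u) (f (D u) s) s) (hgder : ∀ u s, HasDerivAt (g u) (g (D u) s) s)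
    (h0 : ∀ u, f u s₀ = g u s₀) (u : V) (s : ℝ) : f u s = g u s :=
  eqOn_of_hasDerivAt_family isOpen_univ isPreconnected_univ (mem_univ s₀) f g D hf hg
    (fun u s _ => hfder u s) (fun u s _ => hgder u s) h0 u (mem_univ s)

end Literature.Analysis.Calculus

end
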